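import Mathlib
import Summits.MatrixMultiplication.MatrixMultiplication.Theses.FourierTwoFamiliesModP

/-!
# Sketch (crux-ideate round 2, ideator 5) — crux `PrimeTwoFamilies` (stmt-MatrixMultiplication-14308)

Idea `polarized-pairs-signed-designs`: SIGNED two-families designs (SDPP minus "mirror overlaps")
and their exact decoupling into per-index POLARIZED-PAIR conditions against the two aggregates
`X = ⋃ A_i`, `Y = ⋃ B_i`; the transfer `SignedPrimeTwoFamilies → PrimeTwoFamilies` (proved);
the structure pack (cross-sumset Ruzsa bound — proved; quarter law; polarization law — stated).
-/

set_option linter.dupNamespace false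

namespace Summit.MatrixMultiplication.MatrixMultiplication.Cruxes.PrimeTwoFamilies.IdeatorFive

open Finset
open scoped Pointwise
open Summit.MatrixMultiplication.MatrixMultiplication.Theses

section General
variable {G : Type*} [AddCommGroup G] [DecidableEq G] {n : ℕ}

/-- The `A`-sides of the OTHER indices. -/
def othA (A : Fin n → Finset G) (i : Fin n) : Finset G := (univ.erase i).biUnion A
/-- The `B`-sides of the OTHER indices. -/
def othB (B : Fin n → Finset G) (i : Fin n) : Finset G := (univ.erase i).biUnion B

omit [AddCommGroup G] in
theorem mem_othA {A : Fin n → Finset G} {i : Fin n} {x : G} :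
    x ∈ othA A i ↔ ∃ j, j ≠ i ∧ x ∈ A j := by
  simp only [othA, mem_biUnion, mem_erase, mem_univ, and_true]

omit [AddCommGroup G] in
theorem mem_othB {B : Fin n → Finset G} {i : Fin n} {x : G} :
    x ∈ othB B i ↔ ∃ j, j ≠ i ∧ x ∈ B j := by
  simp only [othB, mem_biUnion, mem_erase, mem_univ, and_true]

/-- The three SIGN REGIONS of index `i`: loop `L i = A i + B i`, positive `P i = A i + ⋃_{k≠i} B k`,
negative `N i = (⋃_{j≠i} A j) + B i`. -/
def regL (A B : Fin n → Finset G) (i : Fin n) : Finset G := A i + B i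
def regP (A B : Fin n → Finset G) (i : Fin n) : Finset G := A i + othB B i
def regN (A B : Fin n → Finset G) (i : Fin n) : Finset G := othA A i + B i

/-- A family is SIGNED if for every index its three sign regions are pairwise disjoint.
Equivalently: the SDPP cross clause (X) together with "no mirror overlaps"
`(A i + B k) ∩ (A k + B i) = ∅` for `i ≠ k` (card §Lever). -/
def IsSigned (A B : Fin n → Finset G) : Prop :=
  ∀ i : Fin n, Disjoint (regL A B i) (regP A B i) ∧ Disjoint (regL A B i) (regN A B i) ∧
    Disjoint (regP A B i) (regN A B i)

/-- POLARIZED PAIR relative to ambient sets `(X', Y')` ("the others"): no element of `Y'` is a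
difference `x + b - a` (`x ∈ X' ∪ A₀`, `b ∈ B₀`, `a ∈ A₀`), and symmetrically — the per-index form of
signedness: `IsSigned A B ↔ ∀ i, IsPolarized (othA A i) (othB B i) (A i) (B i)` (card; the easy
unfolding is not formalised here). -/
def IsPolarized (X' Y' A₀ B₀ : Finset G) : Prop :=
  Disjoint Y' ((X' ∪ A₀) + B₀ - A₀) ∧ Disjoint X' ((Y' ∪ B₀) + A₀ - B₀)

/-- FIRST LEMMA (proved): a signed family satisfies the cross clause (X) of the SDPP verbatim. -/
theorem x_of_isSigned {A B : Fin n → Finset G} (h : IsSigned A B) :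
    ∀ i j k : Fin n, ∀ a ∈ A i, ∀ a' ∈ A j, ∀ b ∈ B j, ∀ b' ∈ B k,
      (a - a') + (b - b') = 0 → i = k := by
  intro i j k a ha a' ha' b hb b' hb' h0
  by_contra hik
  have hz : a + b = a' + b' := by
    have e : (a - a') + (b - b') = (a + b) - (a' + b') := by abel
    rw [e] at h0
    exact sub_eq_zero.1 h0
  by_cases hji : j = i
  · subst hji
    -- z ∈ L j (a + b) and z = a' + b' ∈ A j + B k ⊆ P j since k ≠ j
    obtain ⟨hLP, -, -⟩ := h j
    have zP : a' + b' ∈ regP A B j :=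
      add_mem_add ha' (mem_othB.2 ⟨k, fun e => hik e.symm, hb'⟩)
    rw [← hz] at zP
    exact disjoint_left.1 hLP (add_mem_add ha hb : a + b ∈ regL A B j) zP
  · by_cases hjk : j = k
    · subst hjk
      -- z ∈ A i + B j ⊆ N j (i ≠ j) and z = a' + b' ∈ L j
      obtain ⟨-, hLN, -⟩ := h j
      have zN : a + b ∈ regN A B j := add_mem_add (mem_othA.2 ⟨i, fun e => hji e.symm, ha⟩) hb
      rw [hz] at zN
      exact disjoint_left.1 hLN (add_mem_add ha' hb' : a' + b' ∈ regL A B j) zN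
    · -- j ∉ {i, k}: z ∈ A i + B j ⊆ N j and z ∈ A j + B k ⊆ P j
      obtain ⟨-, -, hPN⟩ := h j
      have zN : a + b ∈ regN A B j := add_mem_add (mem_othA.2 ⟨i, fun e => hji e.symm, ha⟩) hb
      have zP : a' + b' ∈ regP A B j := add_mem_add ha' (mem_othB.2 ⟨k, fun e => hjk e.symm, hb'⟩)
      rw [hz] at zN
      exact disjoint_left.1 hPN zP zN

/-- Conversely an SDPP family is signed iff it has no MIRROR OVERLAPS (statement; easy). -/
def SignedIffNoMirrors : Prop :=
  ∀ (G : Type*) [AddCommGroup G] [DecidableEq G] (n : ℕ) (A B : Fin n → Finset G),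
    (∀ i j k : Fin n, ∀ a ∈ A i, ∀ a' ∈ A j, ∀ b ∈ B j, ∀ b' ∈ B k,
      (a - a') + (b - b') = 0 → i = k) →
    (IsSigned A B ↔ ∀ i k : Fin n, i ≠ k → Disjoint (A i + B k) (A k + B i))

/-- STRUCTURE PACK 1 (proved, two Ruzsa triangle inequalities): in ANY family, for indices
`i, j, k` the diagonal sumset of `i` is controlled by three CROSS sumsets:
`|A j|·|B k|·|A i + B i| ≤ |A j + B i|·|A j + B k|·|A i + B k|`.  With `|A|=|B|=s` and `A i + B i`
direct this forces a cross sumset of size `≥ s^{4/3}` in every index triangle (card §Why). -/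
theorem cross_sumset_ruzsa (A B : Fin n → Finset G) (i j k : Fin n) :
    #(A j) * #(B k) * #(A i + B i) ≤ #(A j + B i) * #(A j + B k) * #(A i + B k) := by
  -- step 1: |A j| |A i + B i| ≤ |A j - A i| |A j + B i|
  have h1 : #(A j) * #(A i + B i) ≤ #(A j - A i) * #(A j + B i) :=
    ruzsa_triangle_inequality_add_sub_add (A i) (A j) (B i)
  -- step 2: |A j - A i| |B k| ≤ |A j + B k| |A i + B k|
  have h2 : #(A j - A i) * #(B k) ≤ #(A j + B k) * #(A i + B k) :=
    ruzsa_triangle_inequality_sub_add_add (A j) (B k) (A i)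
  calc #(A j) * #(B k) * #(A i + B i) = (#(A j) * #(A i + B i)) * #(B k) := by ring
    _ ≤ (#(A j - A i) * #(A j + B i)) * #(B k) := Nat.mul_le_mul_right _ h1
    _ = (#(A j - A i) * #(B k)) * #(A j + B i) := by ring
    _ ≤ (#(A j + B k) * #(A i + B k)) * #(A j + B i) := Nat.mul_le_mul_right _ h2
    _ = #(A j + B i) * #(A j + B k) * #(A i + B k) := by ring

/-- STRUCTURE PACK 2 — QUARTER LAW (statement; proof = the sum-incidence digraph
`R_z = {(i,j) : z ∈ A i + B j}` has only backtracking 2-paths under (X), hence is "isolated loops +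
isolated 2-cycles + bipartite sources→sinks", `|R_z| ≤ n²/4 + n`; sum over `z`). -/
def QuarterLaw : Prop :=
  ∀ (G : Type*) [AddCommGroup G] [Fintype G] [DecidableEq G] (n : ℕ) (A B : Fin n → Finset G),
    (∀ i j k : Fin n, ∀ a ∈ A i, ∀ a' ∈ A j, ∀ b ∈ B j, ∀ b' ∈ B k,
      (a - a') + (b - b') = 0 → i = k) →
    4 * ∑ i, ∑ j, #(A i + B j) ≤ Fintype.card G * (n ^ 2 + 4 * n)

/-- STRUCTURE PACK 3 — POLARIZATION LAW (statement): for a SIGNED family each index polarizes the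
host, `|A i + Y| + |X + B i| ≤ |G| + |A i + B i|` (`X, Y` the aggregates), since
`A i + Y = L i ∪ P i`, `X + B i = L i ∪ N i` with `L, P, N` pairwise disjoint. -/
def PolarizationLaw : Prop :=
  ∀ (G : Type*) [AddCommGroup G] [Fintype G] [DecidableEq G] (n : ℕ) (A B : Fin n → Finset G),
    IsSigned A B → ∀ i : Fin n,
      #(A i + univ.biUnion B) + #(univ.biUnion A + B i) ≤ Fintype.card G + #(A i + B i)

end General

/-! ## The transfer `C⁺`: signed prime-cyclic two-families designs -/

/-- `C⁺` = the crux with clause (X) replaced by SIGNEDNESS (stronger: `x_of_isSigned`); (W), host and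
size clauses verbatim. -/
def SignedPrimeTwoFamilies : Prop :=
  ∀ δ : ℝ, 0 < δ → ∀ n₀ : ℕ, ∃ n ≥ n₀, ∃ p : ℕ, p.Prime ∧ ∃ A B : Fin n → Finset (ZMod p),
    (∀ i : Fin n, ∀ a ∈ A i, ∀ a' ∈ A i, ∀ b ∈ B i, ∀ b' ∈ B i,
        (a - a') + (b - b') = 0 → a = a' ∧ b = b') ∧
    IsSigned A B ∧
    (p : ℝ) ≤ (n : ℝ) ^ (2 + δ) ∧
    ∀ i : Fin n, (n : ℝ) ^ (2 - δ) ≤ (((A i).card * (B i).card : ℕ) : ℝ)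

/-- TRANSFER (proved): `C⁺ → crux`. -/
theorem primeTwoFamilies_of_signed (h : SignedPrimeTwoFamilies) :
    FourierTwoFamiliesModP.PrimeTwoFamilies := by
  intro δ hδ n₀
  obtain ⟨n, hn, p, hp, A, B, hW, hS, hpn, hAB⟩ := h δ hδ n₀
  exact ⟨n, hn, p, hp, A, B, hW, x_of_isSigned hS, hpn, hAB⟩

/-- Calibration (kernel check): the half-digit CKSU/CRT cube at `N = 5·7 = 35`, `l = 1`:
`A₀ = {x : x ≡ e (5), x ≡ 0 (7), e ∈ {1,2}}`, `B₀ = {x ≡ 0 (5), x ≡ f (7), f ∈ {1,2,3}}` and the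
swapped pair form a SIGNED family of 2 pairs in `ZMod 35` (digits restricted to the lower half so
that no mirror overlap survives). -/
example : IsSigned (G := ZMod 35) (n := 2)
    ![({21, 7} : Finset (ZMod 35)), ({15, 30, 10} : Finset (ZMod 35))]
    ![({15, 30, 10} : Finset (ZMod 35)), ({21, 7} : Finset (ZMod 35))] := by
  unfold IsSigned regL regP regN othA othB
  decide

end Summit.MatrixMultiplication.MatrixMultiplication.Cruxes.PrimeTwoFamilies.IdeatorFive
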